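import Mathlib
import HarnessLib
import Summits.Ventures.LatticeQCDFlow.Scoring.IndepMHUnnormalised
import Summits.Ventures.LatticeQCDFlow.Exactness.NCMCGeneralSpacePathIMH

/-!
# The Metropolized non-equilibrium sampler (path-IMH over forward evolutions) obeys the certified
# autocorrelation sandwich: `(1 + ρ₁)/(2(1 − ρ₁)) ≤ τ_int(f) ≤ e^{−W_lo} Z₀/Z₁ − 1/2`

HONEST FRAMING: exact (Metropolis-corrected) sampling algorithms for lattice gauge theory;
figures of merit are autocorrelation/cost numbers at stated couplings and volumes; no
continuum-physics claim.

Venture `LatticeQCDFlow` (cell pub-lqcd), topic `Scoring`; FANOUT row 8 (`s0-cpn-nemc`, GEN-12: the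
row's own sampler class — a non-equilibrium switch made exact by a Metropolis test).  NEW WORK of
the cell, not a published result; no definition is introduced.  The instantiation of
`Scoring/IndepMHUnnormalised.lean` (independence Metropolis with an un-normalised weight: positivity,
floors, Doeblin ceiling, window bracket for the normalised target) on row 13's general-state-space
PATH-IMH sampler (`Exactness/NCMCGeneralSpacePathIMH.lean`, `CrooksPair.pathIMH_invariant`: propose a
fresh forward evolution `ω' ∼ P_F`, accept against the current record with
`min 1 e^{−(W(ω') − W(ω))}` — the flow-MCMC of Albergo–Kanwar–Shanahan 2019 with the WORK in place
of `log p/q`; the Metropolized form of the out-of-equilibrium evolutions of Bonanno–Nada–Vadacchino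
2024 and of stochastic normalizing flows, Wu–Köhler–Noé 2020; all NAMED ONLY, nothing is cited as a
fact).

## Content (a Crooks pair `(κF, κR, s, e, W)` from `ν₀` to `ν₁` on records `E`;
## `Z₀ = ν₀(Ω)`, `Z₁ = ν₁(Ω)` finite and non-zero; `κF`, `κR` Markov)

With `q = P_F = fwdPathLaw ν₀ κF` and `w = e^{−W}`, Crooks' relation gives `w · q = (Z₁/Z₀) • P_R`
where `P_R = fwdPathLaw ν₁ κR` is the law of a REVERSE evolution started in target equilibrium
(`bind_rev_eq_smul_revLaw`, **`crooks_withDensity_eq_smul_revLaw`**, `massRatio_spec`).  Hence, for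
the kernel `K = indepMH P_F e^{−W}` of `CrooksPair.pathIMH_invariant` (verbatim, no new object):
* **`pathIMH_invariant_revLaw`** — `P_R` is an invariant PROBABILITY law of `K` (row 13 stated the
  un-normalised form `(Z₀)⁻¹ • ν₁ ∘ κR`); `integral_comp_end_revLaw` — END-POINT observables `φ ∘ e`
  have `P_R`-mean `∫ φ dν₁ / Z₁`: reading the end point of the record is reading the target;
* **`pathIMH_autocov_nonneg`**, `pathIMH_acf_pow_le`, **`pathIMH_tauInt_floor`**,
  `pathIMH_tauInt_ge_rejection` — EVERY bounded measurable observable of the record (in particular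
  every bounded end-point observable) has nonnegative stationary autocovariances, `ρ₁ᵗ ≤ ρ_t`, and,
  when `ρ` is summable, `ρ₁ < 1` and `τ_int ≥ (1 + ρ₁)/(2(1 − ρ₁)) ≥ 1/2 + r/(1 − r)` (`r` the
  `g²`-weighted mean rejection) — NO hypothesis on the work;
* **`pathIMH_doeblin`** — a WORK FLOOR `W ≥ W_lo` on every record gives `K(ω, ·) ≥ ε P_R` with
  `ε = e^{W_lo} Z₁/Z₀ = e^{−(ΔF − W_lo)}` (`ΔF = −log Z₁/Z₀`): `1/ε` is the largest normalised
  importance weight `sup_ω e^{−(W(ω) − ΔF)}` a record can carry;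
* **`pathIMH_tauInt_le`** — `τ_int(f) ≤ e^{−W_lo} Z₀/Z₁ − 1/2` for every bounded measurable
  `P_R`-centred `f`; **`pathIMH_tauInt_le_exp`** — the same as `τ_int(f) ≤ e^{ΔF − W_lo} − 1/2` in the
  free-energy convention `e^{−ΔF} = Z₁/Z₀` of row 13's `NCMCGeneralSpaceDissipation.lean`;
  `pathIMH_abs_acf_le` (`|ρ_t| ≤ (1 − e^{W_lo} Z₁/Z₀)ᵗ`);
  **`pathIMH_autocorrelation_sandwich`** — summability, `ρ₁ < 1`, both bounds, and the two-sided
  window bracket `τ_W(2m) ≤ τ_int ≤ τ_W(2m) + (e^{−W_lo} Z₀/Z₁ − 1)·ρ(2m)` for every `m`, at once.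

Reading (value-free, for rows 13 / 19 / 23 / 24 and the flow seat): the Metropolized switch is an
independence sampler whose importance weight is `e^{−W_d}`, `W_d = W − ΔF` the dissipated work; its
certified ceiling is governed by the most NEGATIVE dissipation a record can carry, exactly as the
flow sampler's is by the flow-equation defect (`e^{2δ} − 1/2`, `Scoring/FlowSamplerAutocorrelation`)
and the finite pool's by the top normalised weight (`W − 1/2`, `Scoring/IMHAutocorrelationEnvelope`);
the floor through the observable's own `ρ₁` and the rejection floor hold with no hypothesis on `W`.
NOT CLAIMED: any number of ours; that `W` is bounded below for a given protocol (true for bounded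
actions on a compact or finite configuration space, not in general); anything for the UN-Metropolized
Jarzynski estimator (row 8's S0-D2 numbers are reweighting, not path-IMH); proposals taken from a
prior-side Markov chain instead of exact prior draws (then `P_F` is not the proposal law — row 13's
caveat stands); unbounded observables.
-/

noncomputable section

namespace Summit.Ventures.LatticeQCDFlow.Scoring

open MeasureTheory ProbabilityTheory Filter Set Summit.Ventures.LatticeQCDFlow.Exactness
open Summit.Ventures.LatticeQCDFlow.Exactness.GeneralNCMC
open scoped ENNReal

/-! ### §2 The path-IMH sampler of a Crooks pair -/

section PathIMH

variable {Ω E : Type*} [MeasurableSpace Ω] [MeasurableSpace E]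
  {ν₀ ν₁ : Measure Ω} [IsFiniteMeasure ν₀] [IsFiniteMeasure ν₁] {κF κR : Kernel Ω E}
  [IsMarkovKernel κF] [IsMarkovKernel κR] {s e : E → Ω} {W : E → ℝ}

omit [IsFiniteMeasure ν₀] [IsMarkovKernel κF] [IsMarkovKernel κR] in
/-- The reverse-evolution law un-normalised: `ν₁ ∘ κR = Z₁ • P_R` (`Z₁ = ν₁(Ω) ≠ 0`). -/
theorem bind_rev_eq_smul_revLaw (h1 : ν₁ univ ≠ 0) :
    ν₁.bind κR = ν₁ univ • fwdPathLaw ν₁ κR := by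
  rw [fwdPathLaw, smul_smul, ENNReal.mul_inv_cancel h1 (measure_ne_top ν₁ univ), one_smul]

omit [IsFiniteMeasure ν₀] [IsMarkovKernel κF] [IsMarkovKernel κR] in
/-- **Crooks, normalised on both sides**: `e^{−W} · P_F = (Z₁/Z₀) • P_R`. -/
theorem crooks_withDensity_eq_smul_revLaw (h1 : ν₁ univ ≠ 0)
    (h : CrooksPair ν₀ ν₁ κF κR s e W) :
    ((fwdPathLaw ν₀ κF).withDensity fun ω => ENNReal.ofReal (Real.exp (-W ω)))
      = ((ν₀ univ)⁻¹ * ν₁ univ) • fwdPathLaw ν₁ κR := by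
  rw [h.fwdPathLaw_withDensity, bind_rev_eq_smul_revLaw h1, smul_smul]

omit [IsMarkovKernel κF] [IsMarkovKernel κR] in
/-- `0 < Z₁/Z₀ < ∞`. -/
theorem massRatio_spec (h0 : ν₀ univ ≠ 0) (h1 : ν₁ univ ≠ 0) :
    (ν₀ univ)⁻¹ * ν₁ univ ≠ 0 ∧ (ν₀ univ)⁻¹ * ν₁ univ ≠ ⊤ ∧
      ((ν₀ univ)⁻¹ * ν₁ univ).toReal = (ν₁ univ).toReal / (ν₀ univ).toReal := by
  refine ⟨mul_ne_zero (ENNReal.inv_ne_zero.2 (measure_ne_top ν₀ univ)) h1,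
    ENNReal.mul_ne_top (ENNReal.inv_ne_top.2 h0) (measure_ne_top ν₁ univ), ?_⟩
  rw [ENNReal.toReal_mul, ENNReal.toReal_inv, inv_mul_eq_div]

/-- **The invariant PROBABILITY law of the path-IMH chain is the reverse-evolution law
`P_R = fwdPathLaw ν₁ κR`** (a reverse evolution started in target equilibrium). -/
theorem pathIMH_invariant_revLaw (h0 : ν₀ univ ≠ 0) (h1 : ν₁ univ ≠ 0)
    (h : CrooksPair ν₀ ν₁ κF κR s e W) :
    haveI := isProbabilityMeasure_fwdPathLaw ν₀ h0 κF
    Kernel.Invariant (indepMH (fwdPathLaw ν₀ κF) fun ω => Real.exp (-W ω)) (fwdPathLaw ν₁ κR) := by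
  haveI := isProbabilityMeasure_fwdPathLaw ν₀ h0 κF
  haveI := isProbabilityMeasure_fwdPathLaw ν₁ h1 κR
  obtain ⟨hZ0, hZtop, -⟩ := massRatio_spec h0 h1
  exact indepMH_invariant_of_smul (Real.measurable_exp.comp h.measurable_W.neg)
    (fun ω => Real.exp_pos _) hZ0 hZtop (crooks_withDensity_eq_smul_revLaw h1 h)

omit [IsFiniteMeasure ν₀] [IsMarkovKernel κF] [IsFiniteMeasure ν₁] in
/-- **End-point observables read the target**: `∫ φ(e ω) dP_R(ω) = ∫ φ d(ν₁/Z₁)` for every bounded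
measurable `φ` on configurations. -/
theorem integral_comp_end_revLaw (h : CrooksPair ν₀ ν₁ κF κR s e W) {φ : Ω → ℝ}
    (hφ : Measurable φ) :
    ∫ ω, φ (e ω) ∂(fwdPathLaw ν₁ κR) = ∫ x, φ x ∂((ν₁ univ)⁻¹ • ν₁) := by
  have hmap : (fwdPathLaw ν₁ κR).map e = (ν₁ univ)⁻¹ • ν₁ := by
    rw [fwdPathLaw, Measure.map_smul, h.map_end_bind_rev]
  rw [← hmap, integral_map h.measurable_e.aemeasurable hφ.aestronglyMeasurable]

/-- **EVERY STATIONARY AUTOCOVARIANCE OF THE PATH-IMH SAMPLER IS NONNEGATIVE**: for every bounded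
measurable observable `g` of the record and every lag, `C_g(t) ≥ 0` under `P_R`. -/
theorem pathIMH_autocov_nonneg (h0 : ν₀ univ ≠ 0) (h1 : ν₁ univ ≠ 0)
    (h : CrooksPair ν₀ ν₁ κF κR s e W) {g : E → ℝ} (hg : Measurable g) {C : ℝ}
    (hC : ∀ ω, |g ω| ≤ C) (t : ℕ) :
    haveI := isProbabilityMeasure_fwdPathLaw ν₀ h0 κF
    0 ≤ autocov (indepMH (fwdPathLaw ν₀ κF) fun ω => Real.exp (-W ω)) (fwdPathLaw ν₁ κR) g t := by
  haveI := isProbabilityMeasure_fwdPathLaw ν₀ h0 κF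
  haveI := isProbabilityMeasure_fwdPathLaw ν₁ h1 κR
  obtain ⟨hZ0, hZtop, -⟩ := massRatio_spec h0 h1
  exact indepMH_autocov_nonneg_of_smul (Real.measurable_exp.comp h.measurable_W.neg)
    (fun ω => Real.exp_pos _) hZ0 hZtop (crooks_withDensity_eq_smul_revLaw h1 h) hg hC t

/-- **`ρ₁ᵗ ≤ ρ_t`** for every bounded measurable observable of the record. -/
theorem pathIMH_acf_pow_le (h0 : ν₀ univ ≠ 0) (h1 : ν₁ univ ≠ 0)
    (h : CrooksPair ν₀ ν₁ κF κR s e W) {g : E → ℝ} (hg : Measurable g) {C : ℝ}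
    (hC : ∀ ω, |g ω| ≤ C) (t : ℕ) :
    haveI := isProbabilityMeasure_fwdPathLaw ν₀ h0 κF
    (autocov (indepMH (fwdPathLaw ν₀ κF) fun ω => Real.exp (-W ω)) (fwdPathLaw ν₁ κR) g 1
        / autocov (indepMH (fwdPathLaw ν₀ κF) fun ω => Real.exp (-W ω)) (fwdPathLaw ν₁ κR) g 0)
          ^ (t + 1)
      ≤ autocov (indepMH (fwdPathLaw ν₀ κF) fun ω => Real.exp (-W ω)) (fwdPathLaw ν₁ κR) g (t + 1)
        / autocov (indepMH (fwdPathLaw ν₀ κF) fun ω => Real.exp (-W ω)) (fwdPathLaw ν₁ κR) g 0 := by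
  haveI := isProbabilityMeasure_fwdPathLaw ν₀ h0 κF
  haveI := isProbabilityMeasure_fwdPathLaw ν₁ h1 κR
  obtain ⟨hZ0, hZtop, -⟩ := massRatio_spec h0 h1
  exact indepMH_acf_pow_le_of_smul (Real.measurable_exp.comp h.measurable_W.neg)
    (fun ω => Real.exp_pos _) hZ0 hZtop (crooks_withDensity_eq_smul_revLaw h1 h) hg hC t

/-- **THE `τ_int` FLOOR OF THE PATH-IMH SAMPLER**: `ρ₁ < 1` and `(1 + ρ₁)/(2(1 − ρ₁)) ≤ τ_int` for
every bounded measurable observable of the record with a summable autocorrelation — no hypothesis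
on the work. -/
theorem pathIMH_tauInt_floor (h0 : ν₀ univ ≠ 0) (h1 : ν₁ univ ≠ 0)
    (h : CrooksPair ν₀ ν₁ κF κR s e W) {g : E → ℝ} (hg : Measurable g) {C : ℝ}
    (hC : ∀ ω, |g ω| ≤ C) :
    haveI := isProbabilityMeasure_fwdPathLaw ν₀ h0 κF
    let ρ : ℕ → ℝ := fun t =>
      autocov (indepMH (fwdPathLaw ν₀ κF) fun ω => Real.exp (-W ω)) (fwdPathLaw ν₁ κR) g t
        / autocov (indepMH (fwdPathLaw ν₀ κF) fun ω => Real.exp (-W ω)) (fwdPathLaw ν₁ κR) g 0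
    (Summable fun t => ρ (t + 1)) → ρ 1 < 1 ∧ (1 + ρ 1) / (2 * (1 - ρ 1)) ≤ tauInt ρ := by
  intro ρ hs
  haveI := isProbabilityMeasure_fwdPathLaw ν₀ h0 κF
  haveI := isProbabilityMeasure_fwdPathLaw ν₁ h1 κR
  obtain ⟨hZ0, hZtop, -⟩ := massRatio_spec h0 h1
  exact indepMH_tauInt_floor_of_smul (Real.measurable_exp.comp h.measurable_W.neg)
    (fun ω => Real.exp_pos _) hZ0 hZtop (crooks_withDensity_eq_smul_revLaw h1 h) hg hC hs

/-- **The rejection floor** `τ_int ≥ 1/2 + r_g/(1 − r_g)` for the path-IMH sampler, `r_g` the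
`g²`-weighted mean rejection probability under `P_R`. -/
theorem pathIMH_tauInt_ge_rejection (h0 : ν₀ univ ≠ 0) (h1 : ν₁ univ ≠ 0)
    (h : CrooksPair ν₀ ν₁ κF κR s e W) {g : E → ℝ} (hg : Measurable g) {C : ℝ}
    (hC : ∀ ω, |g ω| ≤ C) :
    haveI := isProbabilityMeasure_fwdPathLaw ν₀ h0 κF
    let K := indepMH (fwdPathLaw ν₀ κF) fun ω => Real.exp (-W ω)
    let ρ : ℕ → ℝ := fun t => autocov K (fwdPathLaw ν₁ κR) g t / autocov K (fwdPathLaw ν₁ κR) g 0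
    let r := (∫ ω, g ω ^ 2 *
        (1 - (imhAcceptMass (fwdPathLaw ν₀ κF) (fun ω => Real.exp (-W ω)) ω).toReal)
          ∂(fwdPathLaw ν₁ κR)) / autocov K (fwdPathLaw ν₁ κR) g 0
    (Summable fun t => ρ (t + 1)) → (1 + r) / (2 * (1 - r)) ≤ tauInt ρ := by
  intro K ρ r hs
  haveI := isProbabilityMeasure_fwdPathLaw ν₀ h0 κF
  haveI := isProbabilityMeasure_fwdPathLaw ν₁ h1 κR
  obtain ⟨hZ0, hZtop, -⟩ := massRatio_spec h0 h1
  exact indepMH_tauInt_ge_rejection_of_smul (Real.measurable_exp.comp h.measurable_W.neg)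
    (fun ω => Real.exp_pos _) hZ0 hZtop (crooks_withDensity_eq_smul_revLaw h1 h) hg hC hs

omit [IsMarkovKernel κR] in
/-- **A work floor is a Doeblin constant**: if `W ≥ W_lo` on every record, then
`K(ω, ·) ≥ ε P_R` with `ε = (Z₁/Z₀) / e^{−W_lo} = e^{W_lo − ΔF}` — the reciprocal of the largest
normalised importance weight `e^{−(W − ΔF)}` a record can carry. -/
theorem pathIMH_doeblin (h0 : ν₀ univ ≠ 0) (h1 : ν₁ univ ≠ 0)
    (h : CrooksPair ν₀ ν₁ κF κR s e W) {Wlo : ℝ} (hlo : ∀ ω, Wlo ≤ W ω) :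
    haveI := isProbabilityMeasure_fwdPathLaw ν₀ h0 κF
    ∀ ω {B : Set E}, MeasurableSet B →
      (ν₀ univ)⁻¹ * ν₁ univ / ENNReal.ofReal (Real.exp (-Wlo)) * fwdPathLaw ν₁ κR B
        ≤ indepMH (fwdPathLaw ν₀ κF) (fun ω => Real.exp (-W ω)) ω B := by
  haveI := isProbabilityMeasure_fwdPathLaw ν₀ h0 κF
  exact indepMH_doeblin_of_smul (Real.measurable_exp.comp h.measurable_W.neg)
    (fun ω => Real.exp_pos _) (fun ω => Real.exp_le_exp.2 (neg_le_neg (hlo ω)))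
    (crooks_withDensity_eq_smul_revLaw h1 h)

/-- **`τ_int(f) ≤ e^{−W_lo} Z₀/Z₁ − 1/2`** (`= e^{ΔF − W_lo} − 1/2`, `ΔF = −log Z₁/Z₀`) for every
bounded measurable `P_R`-centred observable of the record, under a work floor `W ≥ W_lo`. -/
theorem pathIMH_tauInt_le (h0 : ν₀ univ ≠ 0) (h1 : ν₁ univ ≠ 0)
    (h : CrooksPair ν₀ ν₁ κF κR s e W) {Wlo : ℝ} (hlo : ∀ ω, Wlo ≤ W ω) {f : E → ℝ}
    (hf : Measurable f) {C : ℝ} (hC : ∀ ω, |f ω| ≤ C) (hf0 : ∫ ω, f ω ∂(fwdPathLaw ν₁ κR) = 0) :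
    haveI := isProbabilityMeasure_fwdPathLaw ν₀ h0 κF
    let K := indepMH (fwdPathLaw ν₀ κF) fun ω => Real.exp (-W ω)
    tauInt (fun t => autocov K (fwdPathLaw ν₁ κR) f t / autocov K (fwdPathLaw ν₁ κR) f 0)
      ≤ Real.exp (-Wlo) * ((ν₀ univ).toReal / (ν₁ univ).toReal) - 1 / 2 := by
  intro K
  haveI := isProbabilityMeasure_fwdPathLaw ν₀ h0 κF
  haveI := isProbabilityMeasure_fwdPathLaw ν₁ h1 κR
  obtain ⟨hZ0, hZtop, hZr⟩ := massRatio_spec h0 h1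
  have h' := indepMH_tauInt_le_of_smul (Real.measurable_exp.comp h.measurable_W.neg)
    (fun ω => Real.exp_pos _) (fun ω => Real.exp_le_exp.2 (neg_le_neg (hlo ω))) hZ0 hZtop
    (crooks_withDensity_eq_smul_revLaw h1 h) hf hC hf0
  have hν0 : (ν₀ univ).toReal ≠ 0 := ENNReal.toReal_ne_zero.2 ⟨h0, measure_ne_top ν₀ univ⟩
  have hν1 : (ν₁ univ).toReal ≠ 0 := ENNReal.toReal_ne_zero.2 ⟨h1, measure_ne_top ν₁ univ⟩
  rw [hZr] at h'
  have heq : Real.exp (-Wlo) / ((ν₁ univ).toReal / (ν₀ univ).toReal)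
      = Real.exp (-Wlo) * ((ν₀ univ).toReal / (ν₁ univ).toReal) := by
    field_simp
  rw [heq] at h'
  exact h'

/-- The same ceiling in the free-energy convention of row 13's `NCMCGeneralSpaceDissipation.lean`
(`e^{−ΔF} = Z₁/Z₀`, hypothesis `hΔF`): **`τ_int(f) ≤ e^{ΔF − W_lo} − 1/2`** — the exponential of the
largest NEGATIVE dissipated work `ΔF − W` a record can carry, minus one half. -/
theorem pathIMH_tauInt_le_exp (h0 : ν₀ univ ≠ 0) (h1 : ν₁ univ ≠ 0)
    (h : CrooksPair ν₀ ν₁ κF κR s e W) {Wlo : ℝ} (hlo : ∀ ω, Wlo ≤ W ω) {ΔF : ℝ}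
    (hΔF : Real.exp (-ΔF) = ((ν₀ univ)⁻¹ * ν₁ univ).toReal) {f : E → ℝ}
    (hf : Measurable f) {C : ℝ} (hC : ∀ ω, |f ω| ≤ C) (hf0 : ∫ ω, f ω ∂(fwdPathLaw ν₁ κR) = 0) :
    haveI := isProbabilityMeasure_fwdPathLaw ν₀ h0 κF
    let K := indepMH (fwdPathLaw ν₀ κF) fun ω => Real.exp (-W ω)
    tauInt (fun t => autocov K (fwdPathLaw ν₁ κR) f t / autocov K (fwdPathLaw ν₁ κR) f 0)
      ≤ Real.exp (ΔF - Wlo) - 1 / 2 := by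
  intro K
  haveI := isProbabilityMeasure_fwdPathLaw ν₀ h0 κF
  haveI := isProbabilityMeasure_fwdPathLaw ν₁ h1 κR
  obtain ⟨hZ0, hZtop, -⟩ := massRatio_spec h0 h1
  have h' := indepMH_tauInt_le_of_smul (Real.measurable_exp.comp h.measurable_W.neg)
    (fun ω => Real.exp_pos _) (fun ω => Real.exp_le_exp.2 (neg_le_neg (hlo ω))) hZ0 hZtop
    (crooks_withDensity_eq_smul_revLaw h1 h) hf hC hf0
  have heq : Real.exp (-Wlo) / ((ν₀ univ)⁻¹ * ν₁ univ).toReal = Real.exp (ΔF - Wlo) := by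
    rw [← hΔF, ← Real.exp_sub]
    ring_nf
  rw [heq] at h'
  exact h'

/-- **`|ρ_f(t)| ≤ (1 − e^{W_lo} Z₁/Z₀)ᵗ`** under the same work floor. -/
theorem pathIMH_abs_acf_le (h0 : ν₀ univ ≠ 0) (h1 : ν₁ univ ≠ 0)
    (h : CrooksPair ν₀ ν₁ κF κR s e W) {Wlo : ℝ} (hlo : ∀ ω, Wlo ≤ W ω) {f : E → ℝ}
    (hf : Measurable f) {C : ℝ} (hC : ∀ ω, |f ω| ≤ C) (hf0 : ∫ ω, f ω ∂(fwdPathLaw ν₁ κR) = 0)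
    (t : ℕ) :
    haveI := isProbabilityMeasure_fwdPathLaw ν₀ h0 κF
    let K := indepMH (fwdPathLaw ν₀ κF) fun ω => Real.exp (-W ω)
    |autocov K (fwdPathLaw ν₁ κR) f t / autocov K (fwdPathLaw ν₁ κR) f 0|
      ≤ (1 - Real.exp Wlo * ((ν₁ univ).toReal / (ν₀ univ).toReal)) ^ t := by
  intro K
  haveI := isProbabilityMeasure_fwdPathLaw ν₀ h0 κF
  haveI := isProbabilityMeasure_fwdPathLaw ν₁ h1 κR
  obtain ⟨hZ0, hZtop, hZr⟩ := massRatio_spec h0 h1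
  have h' := indepMH_abs_acf_le_of_smul (Real.measurable_exp.comp h.measurable_W.neg)
    (fun ω => Real.exp_pos _) (fun ω => Real.exp_le_exp.2 (neg_le_neg (hlo ω))) hZ0 hZtop
    (crooks_withDensity_eq_smul_revLaw h1 h) hf hC hf0 t
  rw [hZr] at h'
  have heq : (ν₁ univ).toReal / (ν₀ univ).toReal / Real.exp (-Wlo)
      = Real.exp Wlo * ((ν₁ univ).toReal / (ν₀ univ).toReal) := by
    rw [Real.exp_neg, div_inv_eq_mul, mul_comm]
  rw [heq] at h'
  exact h'

/-- **THE AUTOCORRELATION SANDWICH OF THE PATH-IMH SAMPLER.**  For a Crooks pair with a work floor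
`W ≥ W_lo`, every bounded measurable `P_R`-centred observable `f` of the record has an absolutely
summable autocorrelation, `ρ₁ < 1`, and
`(1 + ρ₁)/(2(1 − ρ₁)) ≤ τ_int(f) ≤ e^{−W_lo} Z₀/Z₁ − 1/2`, together with the two-sided window bracket
`τ_W(2m) ≤ τ_int(f) ≤ τ_W(2m) + (e^{−W_lo} Z₀/Z₁ − 1)·ρ(2m)` for every `m`. -/
theorem pathIMH_autocorrelation_sandwich (h0 : ν₀ univ ≠ 0) (h1 : ν₁ univ ≠ 0)
    (h : CrooksPair ν₀ ν₁ κF κR s e W) {Wlo : ℝ} (hlo : ∀ ω, Wlo ≤ W ω) {f : E → ℝ}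
    (hf : Measurable f) {C : ℝ} (hC : ∀ ω, |f ω| ≤ C) (hf0 : ∫ ω, f ω ∂(fwdPathLaw ν₁ κR) = 0) :
    haveI := isProbabilityMeasure_fwdPathLaw ν₀ h0 κF
    let K := indepMH (fwdPathLaw ν₀ κF) fun ω => Real.exp (-W ω)
    let ρ : ℕ → ℝ := fun t => autocov K (fwdPathLaw ν₁ κR) f t / autocov K (fwdPathLaw ν₁ κR) f 0
    (Summable fun t => ρ (t + 1)) ∧ ρ 1 < 1 ∧
      (1 + ρ 1) / (2 * (1 - ρ 1)) ≤ tauInt ρ ∧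
      tauInt ρ ≤ Real.exp (-Wlo) * ((ν₀ univ).toReal / (ν₁ univ).toReal) - 1 / 2 ∧
      ∀ m : ℕ, tauIntWindow ρ (2 * m) ≤ tauInt ρ ∧
        tauInt ρ ≤ tauIntWindow ρ (2 * m)
          + (Real.exp (-Wlo) * ((ν₀ univ).toReal / (ν₁ univ).toReal) - 1) * ρ (2 * m) := by
  intro K ρ
  haveI := isProbabilityMeasure_fwdPathLaw ν₀ h0 κF
  haveI := isProbabilityMeasure_fwdPathLaw ν₁ h1 κR
  have hw : Measurable fun ω => Real.exp (-W ω) := Real.measurable_exp.comp h.measurable_W.neg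
  have hw0 : ∀ ω, 0 < Real.exp (-W ω) := fun ω => Real.exp_pos _
  haveI : Fact (Measurable fun ω => Real.exp (-W ω)) := ⟨hw⟩
  have hM : ∀ ω, Real.exp (-W ω) ≤ Real.exp (-Wlo) := fun ω => Real.exp_le_exp.2 (neg_le_neg (hlo ω))
  obtain ⟨hZ0, hZtop, hZr⟩ := massRatio_spec h0 h1
  have hπ := crooks_withDensity_eq_smul_revLaw h1 h
  obtain ⟨hε0, -⟩ :=
    doeblinConst_of_smul_spec (Z := (ν₀ univ)⁻¹ * ν₁ univ) (Real.exp_pos (-Wlo)) hZ0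
  have hν0 : (ν₀ univ).toReal ≠ 0 := ENNReal.toReal_ne_zero.2 ⟨h0, measure_ne_top ν₀ univ⟩
  have hν1 : (ν₁ univ).toReal ≠ 0 := ENNReal.toReal_ne_zero.2 ⟨h1, measure_ne_top ν₁ univ⟩
  have hconst : Real.exp (-Wlo) / ((ν₀ univ)⁻¹ * ν₁ univ).toReal
      = Real.exp (-Wlo) * ((ν₀ univ).toReal / (ν₁ univ).toReal) := by
    rw [hZr]
    field_simp
  have hs : Summable fun t => ρ (t + 1) :=
    summable_acf_of_doeblin (indepMH_invariant_of_smul hw hw0 hZ0 hZtop hπ)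
      (indepMH_doeblin_of_smul hw hw0 hM hπ) hε0 hf hC hf0
  obtain ⟨hρ1, hfloor⟩ := indepMH_tauInt_floor_of_smul hw hw0 hZ0 hZtop hπ hf hC hs
  have hceil := indepMH_tauInt_le_of_smul hw hw0 hM hZ0 hZtop hπ hf hC hf0
  rw [hconst] at hceil
  refine ⟨hs, hρ1, hfloor, hceil, fun m => ?_⟩
  have hb := indepMH_window_bracket_of_smul hw hw0 hM hZ0 hZtop hπ hf hC hf0 m
  rw [hconst] at hb
  exact hb

end PathIMH

end Summit.Ventures.LatticeQCDFlow.Scoring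

end
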